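import Summits.RiemannHypothesis.RiemannHypothesis.Theorems.WeilFormatCCinfMargins
import Summits.RiemannHypothesis.RiemannHypothesis.Theorems.WeilFormatCCinfMarginForm
import Summits.RiemannHypothesis.RiemannHypothesis.Theorems.WeilFormatCCinfMajorantForm
import Summits.RiemannHypothesis.RiemannHypothesis.Theorems.WeilFormatCCinfMiddleForm
import HarnessLib

/-!
# Format C, design C∞: the front door with the data inequalities in MATRIX FORM — one kernel PSD check per sector

Route context: Fourier–Galerkin / Schur-complement certificates of Weil positivity on a window ("format C", C∞ door;
cell memo `run/shared/lean/pub/rh-explicit/rh-explicit-weil-10/KERNEL-LEVER.md` §22; supporting stmt-RiemannHypothesis-0098;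
seat rh-explicit-weil-10).  This is `weilPositivityOn_of_cinf_poly` (`WeilFormatCCinfDoorPoly`) with its four DATA
inequalities pre-assembled by the kernel-lane lemmas of §22:

* the exact middle range `Ufin` IS the weighted Gram `T = Σ_m g_m g_mᵀ/w_m` of the RESOLVED three-part columns
  (`cinf_hfin_even/odd`, `WeilFormatCCinfMiddleForm`) — the rung supplies only per-mode weights `0 < w_m ≤ d̂(m)`;
* the family Gram majorant has the BOX SHAPE `Γ(u) = Σ_fΣ_{f'} u_f u_{f'} G(f,f') + Σ_f u_f² c_f` (FamilyGram / GramData /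
  weil-2's `WeilFormatCCinfGramHankel`) — the rung supplies `G`, `c` and the `N`-uniform bound `hΓ`;
* the dominating form `Uq` IS the explicit quadratic form `zᵀQz` (`cinf_hUq'_even/odd`, `WeilFormatCCinfMajorantForm`) — no
  hypothesis left;
* the margin is ONE inequality `δ‖z‖² ≤ zᵀSz` on `Fin (B+1) ⊕ Fin r` for the explicit matrix
  `S = [[M, C + L₁], [(C + L₁)ᵀ, P + L₂]] − Q` of RESOLVED entries (`hS_even/odd_of_entries` ∘ `hS_even/odd_of_quadForm`,
  `WeilFormatCCinfMargins` / `WeilFormatCCinfMarginForm`); `quadForm_margin_of_fin` turns the conclusion of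
  `PsdDyadic.psd_of_checkPsdMid` on the boxed `Fin (B+1+r)`-matrix `S∘e⁻¹ − δ·1` into exactly this hypothesis.

So a rung is: K3's `hPA`, the profiles, the floors, the collected analytic facts at chosen orders (§21), weights, Hankel
boxes with `hΓ`, `θ`, and per sector ONE PSD-with-margin statement about one explicit matrix.

* `weilPositivityOn_of_cinf_matrix`.

Assembly only; standard axioms; no definitions; no RH claim (a rung `WeilPositivityOn a` is one case of
`riemannHypothesis_iff_forall_weilPositivityOn`).
-/

set_option autoImplicit false
-- `Summit.RiemannHypothesis.RiemannHypothesis.…` is the layout-mandated namespace (summit = problem name).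
set_option linter.dupNamespace false

noncomputable section

open Complex Filter Set MeasureTheory Finset
open scoped Real Topology ComplexConjugate ArithmeticFunction.vonMangoldt

namespace Summit.RiemannHypothesis.RiemannHypothesis.Theorems.WeilFormatC

open Literature.NumberTheory.LFunctions Literature.NumberTheory.LFunctions.Yoshida1992
open Literature.Analysis.SpecialFunctions

variable {a : ℝ}


/-- **Format C, C∞ front door in matrix form.**  `weilPositivityOn_of_cinf_poly` with: the exact middle range taken
as the weighted Gram of the resolved three-part columns (weights `0 < w_m ≤ d̂(m)` on `[B+1, m₀)`), the family Gram
majorant in box shape `(G, c)`, the dominating form `Uq := zᵀQz` built in, and per sector ONE margin inequality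
`δ Σ_k z_k² ≤ Σ_k Σ_{k'} z_k z_{k'} S(k,k')` for the explicit resolved-entry matrix `S` printed below.  Conclusion:
`WeilPositivityOn a`. -/
theorem weilPositivityOn_of_cinf_matrix (ha : 0 < a)
    {A : ℝ} (hPA : ∀ (s : Finset ℤ) (c : ℤ → ℂ),
      -(A * ∑ n ∈ s, ‖c n‖ ^ 2) ≤ ∑ n ∈ s, ∑ m ∈ s, (conj (c n) * c m).re * primeCoeff a n m)
    -- ===== EVEN sector =====
    {Be re m₀e : ℕ} (hBe : 1 ≤ Be) (hBme : Be < m₀e) (se : Finset ℕ) (hse : ∀ q ∈ se, Even q)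
    (coefe : Fin re → ℕ → ℝ) (hbe : ∀ j, ∑ q ∈ se, coefe j q * q * a ^ (q - 1) = 0)
    -- far diagonal: floor on [Be+1, ∞), floor on [m₀e, ∞), and `d̂ ≤ d̂_A`
    (de : ℕ → ℝ) {d₀e d₁e : ℝ} (hde₀ : 0 < d₀e) (hde : ∀ m, Be + 1 ≤ m → d₀e ≤ de m)
    (hde₁ : 0 < d₁e) (hde₃ : ∀ m, m₀e ≤ m → d₁e ≤ de m)
    (hdle : ∀ m : ℕ, Be + 1 ≤ m → de m ≤
      (reDigammaQuarter (freq a m) - Real.log π) / 2 - a * (1 + weilArchDensity (2 * a)) / (π ^ 2 * m ^ 2)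
        - 1 / (8 * m) - a * (1 + weilArchDensity (2 * a)) / π ^ 2 * Real.sqrt (8 / ((Be + 1 - 1 : ℕ) : ℝ)) - A / 2)
    -- matrix free map
    (Λ1e : Fin re → Fin (Be + 1) → ℝ) (Λ2e : Fin re → Fin re → ℝ)
    -- collected monomial data on [m₀e, ∞)
    {ιe : Type*} [Fintype ιe] (φe : ιe → ℕ → ℝ) (we : ℕ → ℝ)
    (Prowe : ℕ → ιe → ℝ) (ρrowe : ℕ → ℝ) (hρrowe : ∀ n, 0 ≤ ρrowe n)
    (hrowe : ∀ m, m₀e ≤ m → ∀ n, n ≤ Be →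
      |(if n = 0 then gramCoeff a 0 m else if m = 0 then gramCoeff a n 0
          else (gramCoeff a n m + gramCoeff a n (-(m : ℤ))) / 2)
        - (-1 : ℝ) ^ m * ∑ f, Prowe n f * φe f m| ≤ ρrowe n * we m)
    (Pimge : ℕ → ιe → ℝ) (ρimge : ℕ → ℝ) (hρimge : ∀ q, 0 ≤ ρimge q)
    (himge : ∀ m, m₀e ≤ m → ∀ q ∈ se,
      |(weilWindowSesq a ((Icc (-a) a).indicator fun x : ℝ ↦ ((x : ℂ)) ^ q) (chi a m)).re
        - (-1 : ℝ) ^ m * ∑ f, Pimge q f * φe f m| ≤ ρimge q * we m)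
    (Rtabe : Fin re → ιe → ℝ)
    (hVe : ∀ m, m₀e ≤ m → ∀ j : Fin re,
      ((if m = 0 then 1 else 2) * (Yoshida1992.fourierCoeff a m ((Icc (-a) a).indicator fun x : ℝ ↦ ∑ q ∈ se, ((coefe j q : ℝ) : ℂ) * ((x : ℂ)) ^ q)).re / Real.sqrt (2 * a)) = (-1 : ℝ) ^ m * ∑ f, Rtabe j f * φe f m)
    -- exact middle range, weights, family Gram, θ, and a dominating Uq
    (wmide : ℕ → ℝ) (hwe : ∀ m ∈ Finset.Ico (Be + 1) m₀e, 0 < wmide m ∧ wmide m ≤ de m)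
    {We : ℝ} (hWe : ∀ N, ∑ m ∈ Ico m₀e N, we m ^ 2 ≤ We)
    (Ge : ιe → ιe → ℝ) (ce : ιe → ℝ)
    (hΓe : ∀ (N : ℕ) (u : ιe → ℝ), ∑ m ∈ Ico m₀e N, (∑ f, u f * φe f m) ^ 2
      ≤ (∑ f, ∑ f', u f * u f' * Ge f f') + ∑ f, u f ^ 2 * ce f)
    {θe : ℝ} (hθe : 0 < θe)
    -- margin (verbatim DoorB)
    {δe : ℝ} (hδe : 0 < δe)
    (hSe : ∀ z : Fin (Be + 1) ⊕ Fin re → ℝ, δe * ∑ k, z k ^ 2 ≤ ∑ k, ∑ k', z k * z k' *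
          (Sum.elim
              (fun i : Fin (Be + 1) ↦ Sum.elim (fun i' : Fin (Be + 1) ↦ (if (i : ℕ) = 0 then gramCoeff a 0 (i' : ℕ) else if (i' : ℕ) = 0 then gramCoeff a (i : ℕ) 0 else (gramCoeff a (i : ℕ) (i' : ℕ) + gramCoeff a (i : ℕ) (-(((i' : ℕ)) : ℤ))) / 2))
                (fun j : Fin re ↦ (((weilWindowSesq a ((Icc (-a) a).indicator fun x : ℝ ↦ ∑ q ∈ se, ((coefe j q : ℝ) : ℂ) * ((x : ℂ)) ^ q) (chiEven a (i : ℕ))).re / (if (i : ℕ) = 0 then 1 else Real.sqrt 2)) - ∑ n ∈ Finset.range (Be + 1), (if n = 0 then gramCoeff a 0 (i : ℕ) else if (i : ℕ) = 0 then gramCoeff a n 0 else (gramCoeff a n (i : ℕ) + gramCoeff a n (-(((i : ℕ)) : ℤ))) / 2) * ((if n = 0 then 1 else 2) * (Yoshida1992.fourierCoeff a n ((Icc (-a) a).indicator fun x : ℝ ↦ ∑ q ∈ se, ((coefe j q : ℝ) : ℂ) * ((x : ℂ)) ^ q)).re / Real.sqrt (2 * a)))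
                  + (Λ1e j i - ∑ j₀, Λ1e j₀ i * (2 * (∫ x, ((Icc (-a) a).indicator fun x : ℝ ↦ ∑ q ∈ se, ((coefe j₀ q : ℝ) : ℂ) * ((x : ℂ)) ^ q) x * conj (((Icc (-a) a).indicator fun x : ℝ ↦ ∑ q ∈ se, ((coefe j q : ℝ) : ℂ) * ((x : ℂ)) ^ q) x)).re - 2 * (((Yoshida1992.fourierCoeff a 0 ((Icc (-a) a).indicator fun x : ℝ ↦ ∑ q ∈ se, ((coefe j₀ q : ℝ) : ℂ) * ((x : ℂ)) ^ q)).re / Real.sqrt (2 * a)) * ((Yoshida1992.fourierCoeff a 0 ((Icc (-a) a).indicator fun x : ℝ ↦ ∑ q ∈ se, ((coefe j q : ℝ) : ℂ) * ((x : ℂ)) ^ q)).re / Real.sqrt (2 * a)))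
                        - ∑ n ∈ Finset.Ico 1 (Be + 1), (2 * (Yoshida1992.fourierCoeff a n ((Icc (-a) a).indicator fun x : ℝ ↦ ∑ q ∈ se, ((coefe j₀ q : ℝ) : ℂ) * ((x : ℂ)) ^ q)).re / Real.sqrt (2 * a)) * (2 * (Yoshida1992.fourierCoeff a n ((Icc (-a) a).indicator fun x : ℝ ↦ ∑ q ∈ se, ((coefe j q : ℝ) : ℂ) * ((x : ℂ)) ^ q)).re / Real.sqrt (2 * a))))) k')
              (fun j : Fin re ↦ Sum.elim (fun i' : Fin (Be + 1) ↦ (((weilWindowSesq a ((Icc (-a) a).indicator fun x : ℝ ↦ ∑ q ∈ se, ((coefe j q : ℝ) : ℂ) * ((x : ℂ)) ^ q) (chiEven a (i' : ℕ))).re / (if (i' : ℕ) = 0 then 1 else Real.sqrt 2)) - ∑ n ∈ Finset.range (Be + 1), (if n = 0 then gramCoeff a 0 (i' : ℕ) else if (i' : ℕ) = 0 then gramCoeff a n 0 else (gramCoeff a n (i' : ℕ) + gramCoeff a n (-(((i' : ℕ)) : ℤ))) / 2) * ((if n = 0 then 1 else 2) * (Yoshida1992.fourierCoeff a n ((Icc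 (-a) a).indicator fun x : ℝ ↦ ∑ q ∈ se, ((coefe j q : ℝ) : ℂ) * ((x : ℂ)) ^ q)).re / Real.sqrt (2 * a)))
                  + (Λ1e j i' - ∑ j₀, Λ1e j₀ i' * (2 * (∫ x, ((Icc (-a) a).indicator fun x : ℝ ↦ ∑ q ∈ se, ((coefe j₀ q : ℝ) : ℂ) * ((x : ℂ)) ^ q) x * conj (((Icc (-a) a).indicator fun x : ℝ ↦ ∑ q ∈ se, ((coefe j q : ℝ) : ℂ) * ((x : ℂ)) ^ q) x)).re - 2 * (((Yoshida1992.fourierCoeff a 0 ((Icc (-a) a).indicator fun x : ℝ ↦ ∑ q ∈ se, ((coefe j₀ q : ℝ) : ℂ) * ((x : ℂ)) ^ q)).re / Real.sqrt (2 * a)) * ((Yoshida1992.fourierCoeff a 0 ((Icc (-a) a).indicator fun x : ℝ ↦ ∑ q ∈ se, ((coefe j q : ℝ) : ℂ) * ((x : ℂ)) ^ q)).re / Real.sqrt (2 * a)))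
                        - ∑ n ∈ Finset.Ico 1 (Be + 1), (2 * (Yoshida1992.fourierCoeff a n ((Icc (-a) a).indicator fun x : ℝ ↦ ∑ q ∈ se, ((coefe j₀ q : ℝ) : ℂ) * ((x : ℂ)) ^ q)).re / Real.sqrt (2 * a)) * (2 * (Yoshida1992.fourierCoeff a n ((Icc (-a) a).indicator fun x : ℝ ↦ ∑ q ∈ se, ((coefe j q : ℝ) : ℂ) * ((x : ℂ)) ^ q)).re / Real.sqrt (2 * a)))))
                (fun j' : Fin re ↦ ((weilWindowSesq a ((Icc (-a) a).indicator fun x : ℝ ↦ ∑ q ∈ se, ((coefe j q : ℝ) : ℂ) * ((x : ℂ)) ^ q) ((Icc (-a) a).indicator fun x : ℝ ↦ ∑ q ∈ se, ((coefe j' q : ℝ) : ℂ) * ((x : ℂ)) ^ q)).re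
                      - ∑ n ∈ Finset.range (Be + 1), ((if n = 0 then 1 else 2) * (Yoshida1992.fourierCoeff a n ((Icc (-a) a).indicator fun x : ℝ ↦ ∑ q ∈ se, ((coefe j' q : ℝ) : ℂ) * ((x : ℂ)) ^ q)).re / Real.sqrt (2 * a)) * ((weilWindowSesq a ((Icc (-a) a).indicator fun x : ℝ ↦ ∑ q ∈ se, ((coefe j q : ℝ) : ℂ) * ((x : ℂ)) ^ q) (chiEven a n)).re / (if n = 0 then 1 else Real.sqrt 2))
                      - ∑ n ∈ Finset.range (Be + 1), ((if n = 0 then 1 else 2) * (Yoshida1992.fourierCoeff a n ((Icc (-a) a).indicator fun x : ℝ ↦ ∑ q ∈ se, ((coefe j q : ℝ) : ℂ) * ((x : ℂ)) ^ q)).re / Real.sqrt (2 * a)) * ((weilWindowSesq a ((Icc (-a) a).indicator fun x : ℝ ↦ ∑ q ∈ se, ((coefe j' q : ℝ) : ℂ) * ((x : ℂ)) ^ q) (chiEven a n)).re / (if n = 0 then 1 else Real.sqrt 2))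
                      + ∑ n ∈ Finset.range (Be + 1), ((if n = 0 then 1 else 2) * (Yoshida1992.fourierCoeff a n ((Icc (-a) a).indicator fun x : ℝ ↦ ∑ q ∈ se, ((coefe j' q : ℝ) : ℂ) * ((x : ℂ)) ^ q)).re / Real.sqrt (2 * a)) * ∑ n' ∈ Finset.range (Be + 1), (if n' = 0 then gramCoeff a 0 n else if n = 0 then gramCoeff a n' 0 else (gramCoeff a n' n + gramCoeff a n' (-((n) : ℤ))) / 2) * ((if n' = 0 then 1 else 2) * (Yoshida1992.fourierCoeff a n' ((Icc (-a) a).indicator fun x : ℝ ↦ ∑ q ∈ se, ((coefe j q : ℝ) : ℂ) * ((x : ℂ)) ^ q)).re / Real.sqrt (2 * a)))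
                  + (Λ2e j' j + Λ2e j j' - ∑ j₀, Λ2e j₀ j * (2 * (∫ x, ((Icc (-a) a).indicator fun x : ℝ ↦ ∑ q ∈ se, ((coefe j₀ q : ℝ) : ℂ) * ((x : ℂ)) ^ q) x * conj (((Icc (-a) a).indicator fun x : ℝ ↦ ∑ q ∈ se, ((coefe j' q : ℝ) : ℂ) * ((x : ℂ)) ^ q) x)).re - 2 * (((Yoshida1992.fourierCoeff a 0 ((Icc (-a) a).indicator fun x : ℝ ↦ ∑ q ∈ se, ((coefe j₀ q : ℝ) : ℂ) * ((x : ℂ)) ^ q)).re / Real.sqrt (2 * a)) * ((Yoshida1992.fourierCoeff a 0 ((Icc (-a) a).indicator fun x : ℝ ↦ ∑ q ∈ se, ((coefe j' q : ℝ) : ℂ) * ((x : ℂ)) ^ q)).re / Real.sqrt (2 * a)))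
                        - ∑ n ∈ Finset.Ico 1 (Be + 1), (2 * (Yoshida1992.fourierCoeff a n ((Icc (-a) a).indicator fun x : ℝ ↦ ∑ q ∈ se, ((coefe j₀ q : ℝ) : ℂ) * ((x : ℂ)) ^ q)).re / Real.sqrt (2 * a)) * (2 * (Yoshida1992.fourierCoeff a n ((Icc (-a) a).indicator fun x : ℝ ↦ ∑ q ∈ se, ((coefe j' q : ℝ) : ℂ) * ((x : ℂ)) ^ q)).re / Real.sqrt (2 * a))) - ∑ j₀, Λ2e j₀ j' * (2 * (∫ x, ((Icc (-a) a).indicator fun x : ℝ ↦ ∑ q ∈ se, ((coefe j₀ q : ℝ) : ℂ) * ((x : ℂ)) ^ q) x * conj (((Icc (-a) a).indicator fun x : ℝ ↦ ∑ q ∈ se, ((coefe j q : ℝ) : ℂ) * ((x : ℂ)) ^ q) x)).re - 2 * (((Yoshida1992.fourierCoeff a 0 ((Icc (-a) a).indicator fun x : ℝ ↦ ∑ q ∈ se, ((coefe j₀ q : ℝ) : ℂ) * ((x : ℂ)) ^ q)).re / Real.sqrt (2 * a)) * ((Yoshida1992.fourierCoeff a 0 ((Icc (-a) a).indicator fun x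 : ℝ ↦ ∑ q ∈ se, ((coefe j q : ℝ) : ℂ) * ((x : ℂ)) ^ q)).re / Real.sqrt (2 * a)))
                        - ∑ n ∈ Finset.Ico 1 (Be + 1), (2 * (Yoshida1992.fourierCoeff a n ((Icc (-a) a).indicator fun x : ℝ ↦ ∑ q ∈ se, ((coefe j₀ q : ℝ) : ℂ) * ((x : ℂ)) ^ q)).re / Real.sqrt (2 * a)) * (2 * (Yoshida1992.fourierCoeff a n ((Icc (-a) a).indicator fun x : ℝ ↦ ∑ q ∈ se, ((coefe j q : ℝ) : ℂ) * ((x : ℂ)) ^ q)).re / Real.sqrt (2 * a))))) k')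
              k - ((∑ m ∈ Finset.Ico (Be + 1) m₀e,
            Sum.elim
                (fun i : Fin (Be + 1) ↦ (if (i : ℕ) = 0 then gramCoeff a 0 m else if m = 0 then gramCoeff a i 0
            else (gramCoeff a i m + gramCoeff a i (-(m : ℤ))) / 2)
                  - ∑ j, ((if m = 0 then 1 else 2) * (Yoshida1992.fourierCoeff a m ((Icc (-a) a).indicator fun x : ℝ ↦ ∑ q ∈ se, ((coefe j q : ℝ) : ℂ) * ((x : ℂ)) ^ q)).re / Real.sqrt (2 * a)) * Λ1e j i)
                (fun j' : Fin re ↦ (((weilWindowSesq a ((Icc (-a) a).indicator fun x : ℝ ↦ ∑ q ∈ se, ((coefe j' q : ℝ) : ℂ) * ((x : ℂ)) ^ q) (chiEven a m)).re / (if m = 0 then 1 else Real.sqrt 2))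
                - ∑ n ∈ Finset.range (Be + 1), (if n = 0 then gramCoeff a 0 m else if m = 0 then gramCoeff a n 0 else (gramCoeff a n m + gramCoeff a n (-((m) : ℤ))) / 2) * ((if n = 0 then 1 else 2) * (Yoshida1992.fourierCoeff a n ((Icc (-a) a).indicator fun x : ℝ ↦ ∑ q ∈ se, ((coefe j' q : ℝ) : ℂ) * ((x : ℂ)) ^ q)).re / Real.sqrt (2 * a)))
                  - ∑ j, ((if m = 0 then 1 else 2) * (Yoshida1992.fourierCoeff a m ((Icc (-a) a).indicator fun x : ℝ ↦ ∑ q ∈ se, ((coefe j q : ℝ) : ℂ) * ((x : ℂ)) ^ q)).re / Real.sqrt (2 * a)) * Λ2e j j') k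
            * Sum.elim
                (fun i : Fin (Be + 1) ↦ (if (i : ℕ) = 0 then gramCoeff a 0 m else if m = 0 then gramCoeff a i 0
            else (gramCoeff a i m + gramCoeff a i (-(m : ℤ))) / 2)
                  - ∑ j, ((if m = 0 then 1 else 2) * (Yoshida1992.fourierCoeff a m ((Icc (-a) a).indicator fun x : ℝ ↦ ∑ q ∈ se, ((coefe j q : ℝ) : ℂ) * ((x : ℂ)) ^ q)).re / Real.sqrt (2 * a)) * Λ1e j i)
                (fun j' : Fin re ↦ (((weilWindowSesq a ((Icc (-a) a).indicator fun x : ℝ ↦ ∑ q ∈ se, ((coefe j' q : ℝ) : ℂ) * ((x : ℂ)) ^ q) (chiEven a m)).re / (if m = 0 then 1 else Real.sqrt 2))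
                - ∑ n ∈ Finset.range (Be + 1), (if n = 0 then gramCoeff a 0 m else if m = 0 then gramCoeff a n 0 else (gramCoeff a n m + gramCoeff a n (-((m) : ℤ))) / 2) * ((if n = 0 then 1 else 2) * (Yoshida1992.fourierCoeff a n ((Icc (-a) a).indicator fun x : ℝ ↦ ∑ q ∈ se, ((coefe j' q : ℝ) : ℂ) * ((x : ℂ)) ^ q)).re / Real.sqrt (2 * a)))
                  - ∑ j, ((if m = 0 then 1 else 2) * (Yoshida1992.fourierCoeff a m ((Icc (-a) a).indicator fun x : ℝ ↦ ∑ q ∈ se, ((coefe j q : ℝ) : ℂ) * ((x : ℂ)) ^ q)).re / Real.sqrt (2 * a)) * Λ2e j j') k' / wmide m) + ((1 + θe) * ((∑ f, ∑ f', Sum.elim (fun i : Fin (Be + 1) ↦ ((Prowe i f - ∑ j, Rtabe j f * Λ1e j i)))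
                  (fun j' : Fin re ↦ ((∑ q ∈ se, coefe j' q * Pimge q f
                      - ∑ n ∈ Finset.range (Be + 1), ((if n = 0 then 1 else 2) * (Yoshida1992.fourierCoeff a n ((Icc (-a) a).indicator fun x : ℝ ↦ ∑ q ∈ se, ((coefe j' q : ℝ) : ℂ) * ((x : ℂ)) ^ q)).re / Real.sqrt (2 * a)) * Prowe n f)
                    - ∑ j, Rtabe j f * Λ2e j j')) k
                * Sum.elim (fun i : Fin (Be + 1) ↦ ((Prowe i f' - ∑ j, Rtabe j f' * Λ1e j i)))
                  (fun j' : Fin re ↦ ((∑ q ∈ se, coefe j' q * Pimge q f'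
                      - ∑ n ∈ Finset.range (Be + 1), ((if n = 0 then 1 else 2) * (Yoshida1992.fourierCoeff a n ((Icc (-a) a).indicator fun x : ℝ ↦ ∑ q ∈ se, ((coefe j' q : ℝ) : ℂ) * ((x : ℂ)) ^ q)).re / Real.sqrt (2 * a)) * Prowe n f')
                    - ∑ j, Rtabe j f' * Λ2e j j')) k' * Ge f f')
              + ∑ f, ce f * Sum.elim (fun i : Fin (Be + 1) ↦ ((Prowe i f - ∑ j, Rtabe j f * Λ1e j i)))
                  (fun j' : Fin re ↦ ((∑ q ∈ se, coefe j' q * Pimge q f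
                      - ∑ n ∈ Finset.range (Be + 1), ((if n = 0 then 1 else 2) * (Yoshida1992.fourierCoeff a n ((Icc (-a) a).indicator fun x : ℝ ↦ ∑ q ∈ se, ((coefe j' q : ℝ) : ℂ) * ((x : ℂ)) ^ q)).re / Real.sqrt (2 * a)) * Prowe n f)
                    - ∑ j, Rtabe j f * Λ2e j j')) k
                * Sum.elim (fun i : Fin (Be + 1) ↦ ((Prowe i f - ∑ j, Rtabe j f * Λ1e j i)))
                  (fun j' : Fin re ↦ ((∑ q ∈ se, coefe j' q * Pimge q f
                      - ∑ n ∈ Finset.range (Be + 1), ((if n = 0 then 1 else 2) * (Yoshida1992.fourierCoeff a n ((Icc (-a) a).indicator fun x : ℝ ↦ ∑ q ∈ se, ((coefe j' q : ℝ) : ℂ) * ((x : ℂ)) ^ q)).re / Real.sqrt (2 * a)) * Prowe n f)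
                    - ∑ j, Rtabe j f * Λ2e j j')) k')
            + (1 + 1 / θe) * (We * ((∑ i : Fin (Be + 1), ρrowe i
                + ∑ j, (∑ q ∈ se, |coefe j q| * ρimge q
                    + ∑ n ∈ Finset.range (Be + 1), |((if n = 0 then 1 else 2) * (Yoshida1992.fourierCoeff a n ((Icc (-a) a).indicator fun x : ℝ ↦ ∑ q ∈ se, ((coefe j q : ℝ) : ℂ) * ((x : ℂ)) ^ q)).re / Real.sqrt (2 * a))| * ρrowe n))))
              * (if k = k' then Sum.elim (fun i : Fin (Be + 1) ↦ ρrowe i)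
                  (fun j : Fin re ↦ (∑ q ∈ se, |coefe j q| * ρimge q
                    + ∑ n ∈ Finset.range (Be + 1), |((if n = 0 then 1 else 2) * (Yoshida1992.fourierCoeff a n ((Icc (-a) a).indicator fun x : ℝ ↦ ∑ q ∈ se, ((coefe j q : ℝ) : ℂ) * ((x : ℂ)) ^ q)).re / Real.sqrt (2 * a))| * ρrowe n)) k else 0)) / d₁e)))
    -- ===== ODD sector =====
    {Bo ro m₀o : ℕ} (hBo : 1 ≤ Bo) (hBmo : Bo ≤ m₀o) (so : Finset ℕ) (hso : ∀ q ∈ so, Odd q)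
    (coefo : Fin ro → ℕ → ℝ) (hbo : ∀ j, ∑ q ∈ so, coefo j q * a ^ q = 0)
    (dod : ℕ → ℝ) {d₀o d₁o : ℝ} (hdo₀ : 0 < d₀o) (hdo : ∀ m, Bo ≤ m → d₀o ≤ dod m)
    (hdo₁ : 0 < d₁o) (hdo₃ : ∀ m, m₀o ≤ m → d₁o ≤ dod m)
    (hdlo : ∀ k : ℕ, Bo ≤ k → dod k ≤
      (reDigammaQuarter (freq a ((k : ℤ) + 1)) - Real.log π) / 2 - 1 / (8 * ((k : ℝ) + 1))
        - a * (1 + weilArchDensity (2 * a)) / (π ^ 2 * ((k : ℝ) + 1) ^ 2)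
        - (π / 2 - Real.arctan (Real.sqrt Bo / Real.sqrt ((k : ℝ) + 1))) / 2
        - a * (1 + weilArchDensity (2 * a)) / π ^ 2 * Real.sqrt (8 / Bo)
        - A / 2
        - (Real.exp (a / 2) - Real.exp (-(a / 2))) ^ 2 * a / (π ^ 2 * Bo))
    (Λ1o : Fin ro → Fin Bo → ℝ) (Λ2o : Fin ro → Fin ro → ℝ)
    {ιo : Type*} [Fintype ιo] (φo : ιo → ℕ → ℝ) (wo : ℕ → ℝ)
    (Prowo : ℕ → ιo → ℝ) (ρrowo : ℕ → ℝ) (hρrowo : ∀ k, 0 ≤ ρrowo k)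
    (hrowo : ∀ m, m₀o ≤ m → ∀ k, k < Bo →
      |((gramCoeff a ((k + 1 : ℕ) : ℤ) ((m + 1 : ℕ) : ℤ) - gramCoeff a ((k + 1 : ℕ) : ℤ) (-((m + 1 : ℕ) : ℤ))) / 2)
        - (-1 : ℝ) ^ (m + 1) * ∑ f, Prowo k f * φo f m| ≤ ρrowo k * wo m)
    (Pimgo : ℕ → ιo → ℝ) (ρimgo : ℕ → ℝ) (hρimgo : ∀ q, 0 ≤ ρimgo q)
    (himgo : ∀ m, m₀o ≤ m → ∀ q ∈ so,
      |(weilWindowSesq a ((Icc (-a) a).indicator fun x : ℝ ↦ ((x : ℂ)) ^ q) (chi a (m + 1))).im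
        - (-1 : ℝ) ^ (m + 1) * ∑ f, Pimgo q f * φo f m| ≤ ρimgo q * wo m)
    (Rtabo : Fin ro → ιo → ℝ)
    (hVo : ∀ m, m₀o ≤ m → ∀ j : Fin ro,
      (2 * (Yoshida1992.fourierCoeff a ((m + 1 : ℕ) : ℤ) ((Icc (-a) a).indicator fun x : ℝ ↦ ∑ q ∈ so, ((coefo j q : ℝ) : ℂ) * ((x : ℂ)) ^ q)).im / Real.sqrt (2 * a))
        = (-1 : ℝ) ^ (m + 1) * ∑ f, Rtabo j f * φo f m)
    (wmido : ℕ → ℝ) (hwo : ∀ m ∈ Finset.Ico Bo m₀o, 0 < wmido m ∧ wmido m ≤ dod m)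
    {Wo : ℝ} (hWo : ∀ N, ∑ m ∈ Ico m₀o N, wo m ^ 2 ≤ Wo)
    (Go : ιo → ιo → ℝ) (co : ιo → ℝ)
    (hΓo : ∀ (N : ℕ) (u : ιo → ℝ), ∑ m ∈ Ico m₀o N, (∑ f, u f * φo f m) ^ 2
      ≤ (∑ f, ∑ f', u f * u f' * Go f f') + ∑ f, u f ^ 2 * co f)
    {θo : ℝ} (hθo : 0 < θo)
    {δo : ℝ} (hδo : 0 < δo)
    (hSo : ∀ z : Fin Bo ⊕ Fin ro → ℝ, δo * ∑ k, z k ^ 2 ≤ ∑ k, ∑ k', z k * z k' *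
          (Sum.elim
              (fun i : Fin Bo ↦ Sum.elim (fun i' : Fin Bo ↦ ((gramCoeff a (((i : ℕ) : ℤ) + 1) (((i' : ℕ) : ℤ) + 1) - gramCoeff a (((i : ℕ) : ℤ) + 1) (-((((i' : ℕ) : ℤ)) + 1))) / 2))
                (fun j : Fin ro ↦ (((weilWindowSesq a ((Icc (-a) a).indicator fun x : ℝ ↦ ∑ q ∈ so, ((coefo j q : ℝ) : ℂ) * ((x : ℂ)) ^ q) (chiOdd a ((i : ℕ) + 1))).im / Real.sqrt 2) - ∑ k ∈ Finset.Ico 0 Bo, ((gramCoeff a ((k : ℤ) + 1) (((i : ℕ) : ℤ) + 1) - gramCoeff a ((k : ℤ) + 1) (-(((i : ℕ) : ℤ) + 1))) / 2) * (2 * (Yoshida1992.fourierCoeff a ((k : ℤ) + 1) ((Icc (-a) a).indicator fun x : ℝ ↦ ∑ q ∈ so, ((coefo j q : ℝ) : ℂ) * ((x : ℂ)) ^ q)).im / Real.sqrt (2 * a)))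
                  + (Λ1o j i - ∑ j₀, Λ1o j₀ i * (2 * (∫ x, ((Icc (-a) a).indicator fun x : ℝ ↦ ∑ q ∈ so, ((coefo j₀ q : ℝ) : ℂ) * ((x : ℂ)) ^ q) x * conj (((Icc (-a) a).indicator fun x : ℝ ↦ ∑ q ∈ so, ((coefo j q : ℝ) : ℂ) * ((x : ℂ)) ^ q) x)).re
                        - ∑ k ∈ Finset.range Bo, (2 * (Yoshida1992.fourierCoeff a ((k : ℤ) + 1) ((Icc (-a) a).indicator fun x : ℝ ↦ ∑ q ∈ so, ((coefo j₀ q : ℝ) : ℂ) * ((x : ℂ)) ^ q)).im / Real.sqrt (2 * a)) * (2 * (Yoshida1992.fourierCoeff a ((k : ℤ) + 1) ((Icc (-a) a).indicator fun x : ℝ ↦ ∑ q ∈ so, ((coefo j q : ℝ) : ℂ) * ((x : ℂ)) ^ q)).im / Real.sqrt (2 * a))))) k')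
              (fun j : Fin ro ↦ Sum.elim (fun i' : Fin Bo ↦ (((weilWindowSesq a ((Icc (-a) a).indicator fun x : ℝ ↦ ∑ q ∈ so, ((coefo j q : ℝ) : ℂ) * ((x : ℂ)) ^ q) (chiOdd a ((i' : ℕ) + 1))).im / Real.sqrt 2) - ∑ k ∈ Finset.Ico 0 Bo, ((gramCoeff a ((k : ℤ) + 1) (((i' : ℕ) : ℤ) + 1) - gramCoeff a ((k : ℤ) + 1) (-(((i' : ℕ) : ℤ) + 1))) / 2) * (2 * (Yoshida1992.fourierCoeff a ((k : ℤ) + 1) ((Icc (-a) a).indicator fun x : ℝ ↦ ∑ q ∈ so, ((coefo j q : ℝ) : ℂ) * ((x : ℂ)) ^ q)).im / Real.sqrt (2 * a)))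
                  + (Λ1o j i' - ∑ j₀, Λ1o j₀ i' * (2 * (∫ x, ((Icc (-a) a).indicator fun x : ℝ ↦ ∑ q ∈ so, ((coefo j₀ q : ℝ) : ℂ) * ((x : ℂ)) ^ q) x * conj (((Icc (-a) a).indicator fun x : ℝ ↦ ∑ q ∈ so, ((coefo j q : ℝ) : ℂ) * ((x : ℂ)) ^ q) x)).re
                        - ∑ k ∈ Finset.range Bo, (2 * (Yoshida1992.fourierCoeff a ((k : ℤ) + 1) ((Icc (-a) a).indicator fun x : ℝ ↦ ∑ q ∈ so, ((coefo j₀ q : ℝ) : ℂ) * ((x : ℂ)) ^ q)).im / Real.sqrt (2 * a)) * (2 * (Yoshida1992.fourierCoeff a ((k : ℤ) + 1) ((Icc (-a) a).indicator fun x : ℝ ↦ ∑ q ∈ so, ((coefo j q : ℝ) : ℂ) * ((x : ℂ)) ^ q)).im / Real.sqrt (2 * a)))))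
                (fun j' : Fin ro ↦ ((weilWindowSesq a ((Icc (-a) a).indicator fun x : ℝ ↦ ∑ q ∈ so, ((coefo j q : ℝ) : ℂ) * ((x : ℂ)) ^ q) ((Icc (-a) a).indicator fun x : ℝ ↦ ∑ q ∈ so, ((coefo j' q : ℝ) : ℂ) * ((x : ℂ)) ^ q)).re
                      - ∑ k ∈ Finset.Ico 0 Bo, (2 * (Yoshida1992.fourierCoeff a ((k : ℤ) + 1) ((Icc (-a) a).indicator fun x : ℝ ↦ ∑ q ∈ so, ((coefo j' q : ℝ) : ℂ) * ((x : ℂ)) ^ q)).im / Real.sqrt (2 * a)) * ((weilWindowSesq a ((Icc (-a) a).indicator fun x : ℝ ↦ ∑ q ∈ so, ((coefo j q : ℝ) : ℂ) * ((x : ℂ)) ^ q) (chiOdd a (k + 1))).im / Real.sqrt 2)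
                      - ∑ k ∈ Finset.Ico 0 Bo, (2 * (Yoshida1992.fourierCoeff a ((k : ℤ) + 1) ((Icc (-a) a).indicator fun x : ℝ ↦ ∑ q ∈ so, ((coefo j q : ℝ) : ℂ) * ((x : ℂ)) ^ q)).im / Real.sqrt (2 * a)) * ((weilWindowSesq a ((Icc (-a) a).indicator fun x : ℝ ↦ ∑ q ∈ so, ((coefo j' q : ℝ) : ℂ) * ((x : ℂ)) ^ q) (chiOdd a (k + 1))).im / Real.sqrt 2)
                      + ∑ k ∈ Finset.Ico 0 Bo, (2 * (Yoshida1992.fourierCoeff a ((k : ℤ) + 1) ((Icc (-a) a).indicator fun x : ℝ ↦ ∑ q ∈ so, ((coefo j' q : ℝ) : ℂ) * ((x : ℂ)) ^ q)).im / Real.sqrt (2 * a)) * ∑ k' ∈ Finset.Ico 0 Bo, ((gramCoeff a ((k' : ℤ) + 1) ((k : ℤ) + 1) - gramCoeff a ((k' : ℤ) + 1) (-((k : ℤ) + 1))) / 2) * (2 * (Yoshida1992.fourierCoeff a ((k' : ℤ) + 1) ((Icc (-a) a).indicator fun x : ℝ ↦ ∑ q ∈ so, ((coefo j q : ℝ)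 : ℂ) * ((x : ℂ)) ^ q)).im / Real.sqrt (2 * a)))
                  + (Λ2o j' j + Λ2o j j' - ∑ j₀, Λ2o j₀ j * (2 * (∫ x, ((Icc (-a) a).indicator fun x : ℝ ↦ ∑ q ∈ so, ((coefo j₀ q : ℝ) : ℂ) * ((x : ℂ)) ^ q) x * conj (((Icc (-a) a).indicator fun x : ℝ ↦ ∑ q ∈ so, ((coefo j' q : ℝ) : ℂ) * ((x : ℂ)) ^ q) x)).re
                        - ∑ k ∈ Finset.range Bo, (2 * (Yoshida1992.fourierCoeff a ((k : ℤ) + 1) ((Icc (-a) a).indicator fun x : ℝ ↦ ∑ q ∈ so, ((coefo j₀ q : ℝ) : ℂ) * ((x : ℂ)) ^ q)).im / Real.sqrt (2 * a)) * (2 * (Yoshida1992.fourierCoeff a ((k : ℤ) + 1) ((Icc (-a) a).indicator fun x : ℝ ↦ ∑ q ∈ so, ((coefo j' q : ℝ) : ℂ) * ((x : ℂ)) ^ q)).im / Real.sqrt (2 * a))) - ∑ j₀, Λ2o j₀ j' * (2 * (∫ x, ((Icc (-a) a).indicator fun x : ℝ ↦ ∑ q ∈ so, ((coefo j₀ q :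 ℝ) : ℂ) * ((x : ℂ)) ^ q) x * conj (((Icc (-a) a).indicator fun x : ℝ ↦ ∑ q ∈ so, ((coefo j q : ℝ) : ℂ) * ((x : ℂ)) ^ q) x)).re
                        - ∑ k ∈ Finset.range Bo, (2 * (Yoshida1992.fourierCoeff a ((k : ℤ) + 1) ((Icc (-a) a).indicator fun x : ℝ ↦ ∑ q ∈ so, ((coefo j₀ q : ℝ) : ℂ) * ((x : ℂ)) ^ q)).im / Real.sqrt (2 * a)) * (2 * (Yoshida1992.fourierCoeff a ((k : ℤ) + 1) ((Icc (-a) a).indicator fun x : ℝ ↦ ∑ q ∈ so, ((coefo j q : ℝ) : ℂ) * ((x : ℂ)) ^ q)).im / Real.sqrt (2 * a))))) k')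
              k - ((∑ m ∈ Finset.Ico Bo m₀o,
            Sum.elim
                (fun i : Fin Bo ↦ ((gramCoeff a (((i : ℕ) : ℤ) + 1) ((m : ℤ) + 1) - gramCoeff a (((i : ℕ) : ℤ) + 1) (-((m : ℤ) + 1))) / 2)
                  - ∑ j, (2 * (Yoshida1992.fourierCoeff a ((m : ℤ) + 1) ((Icc (-a) a).indicator fun x : ℝ ↦ ∑ q ∈ so, ((coefo j q : ℝ) : ℂ) * ((x : ℂ)) ^ q)).im / Real.sqrt (2 * a)) * Λ1o j i)
                (fun j' : Fin ro ↦ (((weilWindowSesq a ((Icc (-a) a).indicator fun x : ℝ ↦ ∑ q ∈ so, ((coefo j' q : ℝ) : ℂ) * ((x : ℂ)) ^ q) (chiOdd a (m + 1))).im / Real.sqrt 2)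
                - ∑ k ∈ Finset.Ico 0 Bo, ((gramCoeff a ((k : ℤ) + 1) ((m : ℤ) + 1) - gramCoeff a ((k : ℤ) + 1) (-((m : ℤ) + 1))) / 2) * (2 * (Yoshida1992.fourierCoeff a ((k : ℤ) + 1) ((Icc (-a) a).indicator fun x : ℝ ↦ ∑ q ∈ so, ((coefo j' q : ℝ) : ℂ) * ((x : ℂ)) ^ q)).im / Real.sqrt (2 * a)))
                  - ∑ j, (2 * (Yoshida1992.fourierCoeff a ((m : ℤ) + 1) ((Icc (-a) a).indicator fun x : ℝ ↦ ∑ q ∈ so, ((coefo j q : ℝ) : ℂ) * ((x : ℂ)) ^ q)).im / Real.sqrt (2 * a)) * Λ2o j j') k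
            * Sum.elim
                (fun i : Fin Bo ↦ ((gramCoeff a (((i : ℕ) : ℤ) + 1) ((m : ℤ) + 1) - gramCoeff a (((i : ℕ) : ℤ) + 1) (-((m : ℤ) + 1))) / 2)
                  - ∑ j, (2 * (Yoshida1992.fourierCoeff a ((m : ℤ) + 1) ((Icc (-a) a).indicator fun x : ℝ ↦ ∑ q ∈ so, ((coefo j q : ℝ) : ℂ) * ((x : ℂ)) ^ q)).im / Real.sqrt (2 * a)) * Λ1o j i)
                (fun j' : Fin ro ↦ (((weilWindowSesq a ((Icc (-a) a).indicator fun x : ℝ ↦ ∑ q ∈ so, ((coefo j' q : ℝ) : ℂ) * ((x : ℂ)) ^ q) (chiOdd a (m + 1))).im / Real.sqrt 2)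
                - ∑ k ∈ Finset.Ico 0 Bo, ((gramCoeff a ((k : ℤ) + 1) ((m : ℤ) + 1) - gramCoeff a ((k : ℤ) + 1) (-((m : ℤ) + 1))) / 2) * (2 * (Yoshida1992.fourierCoeff a ((k : ℤ) + 1) ((Icc (-a) a).indicator fun x : ℝ ↦ ∑ q ∈ so, ((coefo j' q : ℝ) : ℂ) * ((x : ℂ)) ^ q)).im / Real.sqrt (2 * a)))
                  - ∑ j, (2 * (Yoshida1992.fourierCoeff a ((m : ℤ) + 1) ((Icc (-a) a).indicator fun x : ℝ ↦ ∑ q ∈ so, ((coefo j q : ℝ) : ℂ) * ((x : ℂ)) ^ q)).im / Real.sqrt (2 * a)) * Λ2o j j') k' / wmido m) + ((1 + θo) * ((∑ f, ∑ f', Sum.elim (fun i : Fin Bo ↦ ((Prowo i f - ∑ j, Rtabo j f * Λ1o j i)))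
                  (fun j' : Fin ro ↦ ((∑ q ∈ so, coefo j' q * Pimgo q f
                      - ∑ n ∈ Finset.Ico 0 Bo, (2 * (Yoshida1992.fourierCoeff a ((n : ℤ) + 1) ((Icc (-a) a).indicator fun x : ℝ ↦ ∑ q ∈ so, ((coefo j' q : ℝ) : ℂ) * ((x : ℂ)) ^ q)).im / Real.sqrt (2 * a)) * Prowo n f)
                    - ∑ j, Rtabo j f * Λ2o j j')) k
                * Sum.elim (fun i : Fin Bo ↦ ((Prowo i f' - ∑ j, Rtabo j f' * Λ1o j i)))
                  (fun j' : Fin ro ↦ ((∑ q ∈ so, coefo j' q * Pimgo q f'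
                      - ∑ n ∈ Finset.Ico 0 Bo, (2 * (Yoshida1992.fourierCoeff a ((n : ℤ) + 1) ((Icc (-a) a).indicator fun x : ℝ ↦ ∑ q ∈ so, ((coefo j' q : ℝ) : ℂ) * ((x : ℂ)) ^ q)).im / Real.sqrt (2 * a)) * Prowo n f')
                    - ∑ j, Rtabo j f' * Λ2o j j')) k' * Go f f')
              + ∑ f, co f * Sum.elim (fun i : Fin Bo ↦ ((Prowo i f - ∑ j, Rtabo j f * Λ1o j i)))
                  (fun j' : Fin ro ↦ ((∑ q ∈ so, coefo j' q * Pimgo q f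
                      - ∑ n ∈ Finset.Ico 0 Bo, (2 * (Yoshida1992.fourierCoeff a ((n : ℤ) + 1) ((Icc (-a) a).indicator fun x : ℝ ↦ ∑ q ∈ so, ((coefo j' q : ℝ) : ℂ) * ((x : ℂ)) ^ q)).im / Real.sqrt (2 * a)) * Prowo n f)
                    - ∑ j, Rtabo j f * Λ2o j j')) k
                * Sum.elim (fun i : Fin Bo ↦ ((Prowo i f - ∑ j, Rtabo j f * Λ1o j i)))
                  (fun j' : Fin ro ↦ ((∑ q ∈ so, coefo j' q * Pimgo q f
                      - ∑ n ∈ Finset.Ico 0 Bo, (2 * (Yoshida1992.fourierCoeff a ((n : ℤ) + 1) ((Icc (-a) a).indicator fun x : ℝ ↦ ∑ q ∈ so, ((coefo j' q : ℝ) : ℂ) * ((x : ℂ)) ^ q)).im / Real.sqrt (2 * a)) * Prowo n f)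
                    - ∑ j, Rtabo j f * Λ2o j j')) k')
            + (1 + 1 / θo) * (Wo * ((∑ i : Fin Bo, ρrowo i
                + ∑ j, (∑ q ∈ so, |coefo j q| * ρimgo q
                    + ∑ n ∈ Finset.Ico 0 Bo, |(2 * (Yoshida1992.fourierCoeff a ((n : ℤ) + 1) ((Icc (-a) a).indicator fun x : ℝ ↦ ∑ q ∈ so, ((coefo j q : ℝ) : ℂ) * ((x : ℂ)) ^ q)).im / Real.sqrt (2 * a))| * ρrowo n))))
              * (if k = k' then Sum.elim (fun i : Fin Bo ↦ ρrowo i)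
                  (fun j : Fin ro ↦ (∑ q ∈ so, |coefo j q| * ρimgo q
                    + ∑ n ∈ Finset.Ico 0 Bo, |(2 * (Yoshida1992.fourierCoeff a ((n : ℤ) + 1) ((Icc (-a) a).indicator fun x : ℝ ↦ ∑ q ∈ so, ((coefo j q : ℝ) : ℂ) * ((x : ℂ)) ^ q)).im / Real.sqrt (2 * a))| * ρrowo n)) k else 0)) / d₁o))) :
    WeilPositivityOn a :=
  weilPositivityOn_of_cinf_poly ha hPA hBe hBme se hse coefe hbe de hde₀ hde hde₁ hde₃ hdle Λ1e Λ2e φe we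
    Prowe ρrowe hρrowe hrowe Pimge ρimge hρimge himge Rtabe hVe
    -- even: `Ufine`, `Γe`, `Uqe` are INFERRED from the three lemma conclusions (unification)
    _ (cinf_hfin_even ha se hse coefe Λ1e Λ2e de wmide hwe) hWe _ hΓe hθe
    _ (cinf_hUq'_even a se coefe Λ1e Λ2e Prowe ρrowe Pimge ρimge Rtabe We θe d₁e _ Ge ce) hδe
    (hS_even_of_entries ha se hse coefe hbe Λ1e Λ2e _ (hS_even_of_quadForm a se coefe Λ1e Λ2e _ hSe))
    -- odd
    hBo hBmo so hso coefo hbo dod hdo₀ hdo hdo₁ hdo₃ hdlo Λ1o Λ2o φo wo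
    Prowo ρrowo hρrowo hrowo Pimgo ρimgo hρimgo himgo Rtabo hVo
    _ (cinf_hfin_odd ha so hso coefo Λ1o Λ2o dod wmido hwo) hWo _ hΓo hθo
    _ (cinf_hUq'_odd a so coefo Λ1o Λ2o Prowo ρrowo Pimgo ρimgo Rtabo Wo θo d₁o _ Go co) hδo
    (hS_odd_of_entries ha so hso coefo hbo Λ1o Λ2o _ (hS_odd_of_quadForm a so coefo Λ1o Λ2o _ hSo))

end Summit.RiemannHypothesis.RiemannHypothesis.Theorems.WeilFormatC

end
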